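import Mathlib
import HarnessLib
import Literature.Probability.MarkovChains.GraphRandomWalk

/-!
# Networks and reversible Markov chains: the weighted random walk `P(x,y) = c(x,y)/c(x)` (Levin–Peres–Wilmer §9.1)

HONEST FRAMING: exact (Metropolis-corrected) sampling algorithms for lattice gauge theory; figures
of merit are autocorrelation/cost numbers at stated couplings and volumes; no continuum-physics claim.

Source: D. A. Levin, Y. Peres (with E. L. Wilmer), *Markov Chains and Mixing Times*, 2nd ed.,
AMS 2017 [LevinPeres2017], §9.1 "Networks and Reversible Markov Chains", eq. (9.1) and the two
paragraphs proving (i) that the weighted random walk on a network is reversible with respect to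
`π(x) = c(x)/c_G` and (ii) that every reversible chain is the walk on the network with conductances
`c(x,y) = π(x)P(x,y)` (pp. 115–116).  Conventions of `TotalVariation.lean` (`IsRowStochastic`),
`MetropolisHastings.lean` (`DetailedBalance`, `IsStationary`), `PeskunOrdering.lean` (`IsIrreducible`)
and `GraphRandomWalk.lean` (`srwKernel`, `degreeLaw`).  Everything is PROVED (finite sums; 0 named
facts).

A NETWORK on the finite node set `X` is encoded by its CONDUCTANCE MATRIX `c : Matrix X X ℝ`
(`c(x,y) = c(y,x) ≥ 0`, with `c(x,y) = 0` read as "no edge `{x,y}`"; loops `c(x,x) ≥ 0` allowed), every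
node carrying positive total conductance `c(x) = Σ_y c(x,y) > 0` (no isolated node) — `IsConductance c`.
Connectedness of the book's graph `G` is NOT built in; where needed later it enters as irreducibility of
the walk (`IsIrreducible (networkKernel c)`, cf. `networkKernel_pos_iff`).

* `IsConductance c`, `nodeConductance c x = c(x) = Σ_y c(x,y)`, `totalConductance c = c_G = Σ_x c(x)`
  [cite: LevinPeres2017, §9.1 (definitions of `c(x)` and `c_G`)];
* `networkKernel c` — **eq. (9.1)** `P(x,y) = c(x,y)/c(x)`, the WEIGHTED RANDOM WALK on the network;
  a transition matrix (`networkKernel_isRowStochastic`); `P(x,y) > 0 ↔ c(x,y) > 0`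
  [cite: LevinPeres2017, §9.1 eq. (9.1)];
* `networkLaw c` — `π(x) = c(x)/c_G`; **`π(x)P(x,y) = c(x,y)/c_G = π(y)P(y,x)`: the walk is reversible
  with respect to `π`**, hence `π` is stationary (Prop. 1.20), `π > 0`, `Σ π = 1`
  (`LevinPeres2017_sec_9_1_reversible`, `networkLaw_isStationary`) [cite: LevinPeres2017, §9.1
  (display after eq. (9.1)) with Prop. 1.20];
* the converse **"every reversible Markov chain is a weighted random walk on a network"**:
  `reversibleConductance π P = (π(x)P(x,y))_{x,y}` is a conductance matrix with `c(x) = π(x)` and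
  `networkKernel (reversibleConductance π P) = P` (`LevinPeres2017_sec_9_1_converse`)
  [cite: LevinPeres2017, §9.1 (last paragraph, pp. 115–116)];
* the special case of unit conductances on a simple graph: `networkKernel` of the adjacency matrix is
  the simple random walk `srwKernel G` and `networkLaw` is `degreeLaw G` [cite: LevinPeres2017, §9.1
  ("Simple random walk on `G` is the special case where all the edge weights are equal to 1")].

Context (cell pub-lqcd): the network language (Chapter 9) is the book's tool for hitting and commute
times of reversible chains (effective resistance, Thomson's principle, the commute-time identity);
every Metropolis-type sampler of the cell is a reversible chain, i.e. such a network.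
-/

namespace Literature.Probability.MarkovChains

open Finset Matrix SimpleGraph

variable {X : Type*} [Fintype X]

/-- CONDUCTANCES of a network on the node set `X`: `c(x,y) = c(y,x) ≥ 0` for all `x, y` (the value
`0` meaning "no edge") and every node has positive total conductance `Σ_y c(x,y) > 0`.
[cite: LevinPeres2017, §9.1 ("non-negative numbers `{c(e)}`, called conductances … clearly
`c(x,y) = c(y,x)`")] -/
def IsConductance (c : Matrix X X ℝ) : Prop :=
  (∀ x y, c x y = c y x) ∧ (∀ x y, 0 ≤ c x y) ∧ ∀ x, 0 < ∑ y, c x y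

/-- `c(x) = Σ_{y} c(x,y)`. [cite: LevinPeres2017, §9.1 ("where `c(x) = Σ_{y : y ∼ x} c(x,y)`")] -/
def nodeConductance (c : Matrix X X ℝ) (x : X) : ℝ := ∑ y, c x y

/-- `c_G = Σ_{x ∈ V} c(x)`. [cite: LevinPeres2017, §9.1 ("where `c_G = Σ_{x∈V} c(x)`")] -/
def totalConductance (c : Matrix X X ℝ) : ℝ := ∑ x, nodeConductance c x

/-- **Eq. (9.1)**: the WEIGHTED RANDOM WALK on the network, `P(x,y) = c(x,y)/c(x)`.
[cite: LevinPeres2017, §9.1 eq. (9.1)] -/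
noncomputable def networkKernel (c : Matrix X X ℝ) : Matrix X X ℝ :=
  Matrix.of fun x y => c x y / nodeConductance c x

/-- `π(x) = c(x)/c_G`. [cite: LevinPeres2017, §9.1 ("the probability `π` defined by
`π(x) := c(x)/c_G`")] -/
noncomputable def networkLaw (c : Matrix X X ℝ) : X → ℝ :=
  fun x => nodeConductance c x / totalConductance c

/-- The conductances of a REVERSIBLE chain: `c(x,y) = π(x)P(x,y)`. [cite: LevinPeres2017, §9.1
("define conductances on edges by `c(x,y) = π(x)P(x,y)`")] -/
def reversibleConductance (π : X → ℝ) (P : Matrix X X ℝ) : Matrix X X ℝ :=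
  Matrix.of fun x y => π x * P x y

section Basic

variable {c : Matrix X X ℝ}

/-- `c(x)` unfolded. [cite: LevinPeres2017, §9.1 (definition of `c(x)`)] -/
theorem nodeConductance_def (c : Matrix X X ℝ) (x : X) : nodeConductance c x = ∑ y, c x y := rfl

/-- `c_G` unfolded. [cite: LevinPeres2017, §9.1 (definition of `c_G`)] -/
theorem totalConductance_def (c : Matrix X X ℝ) :
    totalConductance c = ∑ x, nodeConductance c x := rfl

/-- `c_G = Σ_x Σ_y c(x,y)`. [cite: LevinPeres2017, §9.1 ("Note that `c_G = Σ_{x∈V} Σ_{y∼x} c(x,y)`")] -/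
theorem totalConductance_eq_sum_sum (c : Matrix X X ℝ) : totalConductance c = ∑ x, ∑ y, c x y := rfl

/-- Entry formula for (9.1). [cite: LevinPeres2017, §9.1 eq. (9.1)] -/
theorem networkKernel_apply (c : Matrix X X ℝ) (x y : X) :
    networkKernel c x y = c x y / nodeConductance c x := rfl

/-- `π(x) = c(x)/c_G` unfolded. [cite: LevinPeres2017, §9.1 (`π(x) := c(x)/c_G`)] -/
theorem networkLaw_apply (c : Matrix X X ℝ) (x : X) :
    networkLaw c x = nodeConductance c x / totalConductance c := rfl

omit [Fintype X] in
/-- `c(x,y) = π(x)P(x,y)` unfolded. [cite: LevinPeres2017, §9.1 (last paragraph)] -/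
theorem reversibleConductance_apply (π : X → ℝ) (P : Matrix X X ℝ) (x y : X) :
    reversibleConductance π P x y = π x * P x y := rfl

namespace IsConductance

/-- `c(x,y) = c(y,x)`. [cite: LevinPeres2017, §9.1 ("clearly `c(x,y) = c(y,x)`")] -/
theorem symm (hc : IsConductance c) (x y : X) : c x y = c y x := hc.1 x y

/-- `c(x,y) ≥ 0`. [cite: LevinPeres2017, §9.1 ("non-negative numbers `{c(e)}`")] -/
theorem nonneg (hc : IsConductance c) (x y : X) : 0 ≤ c x y := hc.2.1 x y

/-- `c(x) > 0`. [cite: LevinPeres2017, §9.1 (eq. (9.1) divides by `c(x)`)] -/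
theorem nodeConductance_pos (hc : IsConductance c) (x : X) : 0 < nodeConductance c x := hc.2.2 x

/-- `c(x) ≠ 0`. [cite: LevinPeres2017, §9.1 (eq. (9.1) divides by `c(x)`)] -/
theorem nodeConductance_ne_zero (hc : IsConductance c) (x : X) : nodeConductance c x ≠ 0 :=
  (hc.nodeConductance_pos x).ne'

/-- `c_G > 0` (the node set is nonempty as soon as one node is named). [cite: LevinPeres2017, §9.1
(`π(x) := c(x)/c_G` divides by `c_G`)] -/
theorem totalConductance_pos [Nonempty X] (hc : IsConductance c) : 0 < totalConductance c :=
  sum_pos (fun x _ => hc.nodeConductance_pos x) univ_nonempty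

/-- `c(x) ≤ c_G`. [cite: LevinPeres2017, §9.1 (`c_G = Σ_x c(x)`)] -/
theorem nodeConductance_le_totalConductance (hc : IsConductance c) (x : X) :
    nodeConductance c x ≤ totalConductance c :=
  single_le_sum (f := fun y => nodeConductance c y) (fun y _ => (hc.nodeConductance_pos y).le)
    (mem_univ x)

end IsConductance

/-! ## The weighted random walk (9.1) is a transition matrix -/

/-- `P(x,y) ≥ 0`. [cite: LevinPeres2017, §9.1 eq. (9.1)] -/
theorem networkKernel_nonneg (hc : IsConductance c) (x y : X) : 0 ≤ networkKernel c x y := by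
  rw [networkKernel_apply]
  exact div_nonneg (hc.nonneg x y) (hc.nodeConductance_pos x).le

/-- `Σ_y P(x,y) = Σ_y c(x,y)/c(x) = 1`. [cite: LevinPeres2017, §9.1 eq. (9.1)] -/
theorem sum_networkKernel (hc : IsConductance c) (x : X) : ∑ y, networkKernel c x y = 1 := by
  simp_rw [networkKernel_apply]
  rw [← sum_div, ← nodeConductance_def, div_self (hc.nodeConductance_ne_zero x)]

/-- **The weighted random walk on a network is a transition matrix.** [cite: LevinPeres2017, §9.1
eq. (9.1) ("Consider the Markov chain on the nodes of `G` with transition matrix …")] -/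
theorem networkKernel_isRowStochastic (hc : IsConductance c) : IsRowStochastic (networkKernel c) :=
  ⟨networkKernel_nonneg hc, sum_networkKernel hc⟩

/-- `P(x,y) > 0` exactly on the edges: `P(x,y) > 0 ↔ c(x,y) > 0`. [cite: LevinPeres2017, §9.1
eq. (9.1)] -/
theorem networkKernel_pos_iff (hc : IsConductance c) {x y : X} :
    0 < networkKernel c x y ↔ 0 < c x y := by
  rw [networkKernel_apply]
  constructor
  · intro h
    rcases (hc.nonneg x y).lt_or_eq with h1 | h1
    · exact h1
    · rw [← h1, zero_div] at h
      exact absurd h (lt_irrefl 0)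
  · intro h
    exact div_pos h (hc.nodeConductance_pos x)

/-- `P(x,y) = 0 ↔ c(x,y) = 0`. [cite: LevinPeres2017, §9.1 eq. (9.1)] -/
theorem networkKernel_eq_zero_iff (hc : IsConductance c) {x y : X} :
    networkKernel c x y = 0 ↔ c x y = 0 := by
  rw [networkKernel_apply, div_eq_zero_iff, or_iff_left (hc.nodeConductance_ne_zero x)]

/-- `c(x) P(x,y) = c(x,y)`. [cite: LevinPeres2017, §9.1 eq. (9.1)] -/
theorem nodeConductance_mul_networkKernel (hc : IsConductance c) (x y : X) :
    nodeConductance c x * networkKernel c x y = c x y := by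
  rw [networkKernel_apply, mul_div_cancel₀ _ (hc.nodeConductance_ne_zero x)]

/-- `Σ_y c(x,y) f(y) = c(x) Σ_y P(x,y) f(y)` — the conversion between network sums and first-step
averages used throughout Chapter 9. [cite: LevinPeres2017, §9.3 (verification of the node law:
"`= c(x)W(x) − c(x) Σ_{y∼x} W(y)P(x,y)`")] -/
theorem sum_conductance_mul_eq (hc : IsConductance c) (x : X) (f : X → ℝ) :
    ∑ y, c x y * f y = nodeConductance c x * ∑ y, networkKernel c x y * f y := by
  rw [mul_sum]
  exact sum_congr rfl fun y _ => by rw [← mul_assoc, nodeConductance_mul_networkKernel hc]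

/-! ## Reversibility: `π(x)P(x,y) = π(y)P(y,x)` with `π(x) = c(x)/c_G` -/

/-- `π(x) > 0`. [cite: LevinPeres2017, §9.1 (`π(x) = c(x)/c_G`)] -/
theorem networkLaw_pos [Nonempty X] (hc : IsConductance c) (x : X) : 0 < networkLaw c x :=
  div_pos (hc.nodeConductance_pos x) hc.totalConductance_pos

/-- `Σ_x π(x) = Σ_x c(x)/c_G = 1`. [cite: LevinPeres2017, §9.1 ("the probability `π` defined by
`π(x) := c(x)/c_G`")] -/
theorem sum_networkLaw [Nonempty X] (hc : IsConductance c) : ∑ x, networkLaw c x = 1 := by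
  simp_rw [networkLaw_apply]
  rw [← sum_div, ← totalConductance_def, div_self hc.totalConductance_pos.ne']

/-- `π(x)P(x,y) = c(x,y)/c_G`. [cite: LevinPeres2017, §9.1 (display after eq. (9.1):
"`π(x)P(x,y) = (c(x)/c_G)(c(x,y)/c(x))`")] -/
theorem networkLaw_mul_networkKernel (hc : IsConductance c) (x y : X) :
    networkLaw c x * networkKernel c x y = c x y / totalConductance c := by
  rw [networkLaw_apply, networkKernel_apply, div_mul_div_comm, mul_comm (nodeConductance c x),
    mul_div_mul_right _ _ (hc.nodeConductance_ne_zero x)]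

/-- **§9.1: the weighted random walk is REVERSIBLE with respect to `π(x) = c(x)/c_G`**:
`π(x)P(x,y) = c(x,y)/c_G = c(y,x)/c_G = π(y)P(y,x)`. [cite: LevinPeres2017, §9.1 (display after
eq. (9.1))] -/
theorem LevinPeres2017_sec_9_1_reversible (hc : IsConductance c) :
    DetailedBalance (networkLaw c) (networkKernel c) := by
  intro x y
  rw [networkLaw_mul_networkKernel hc, networkLaw_mul_networkKernel hc, hc.symm x y]

/-- **`π` is stationary for `P`** ("By Proposition 1.20, `π` is stationary for `P`").
[cite: LevinPeres2017, §9.1 with Prop. 1.20] -/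
theorem networkLaw_isStationary (hc : IsConductance c) : IsStationary (networkLaw c) (networkKernel c) :=
  (LevinPeres2017_sec_9_1_reversible hc).isStationary (sum_networkKernel hc)

/-! ## Every reversible chain is a weighted random walk on a network -/

section Converse

variable {P : Matrix X X ℝ} {π : X → ℝ}

/-- With `c(x,y) = π(x)P(x,y)`: `c(x) = π(x) Σ_y P(x,y) = π(x)`. [cite: LevinPeres2017, §9.1 ("With
this choice of weights, we have `c(x) = π(x)`")] -/
theorem nodeConductance_reversibleConductance (hP : IsRowStochastic P) (x : X) :
    nodeConductance (reversibleConductance π P) x = π x := by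
  rw [nodeConductance_def]
  simp_rw [reversibleConductance_apply]
  rw [← mul_sum, hP.2 x, mul_one]

/-- `c_G = Σ_x π(x)` (`= 1` for a probability vector). [cite: LevinPeres2017, §9.1 (`c(x) = π(x)`)] -/
theorem totalConductance_reversibleConductance (hP : IsRowStochastic P) :
    totalConductance (reversibleConductance π P) = ∑ x, π x := by
  rw [totalConductance_def]
  exact sum_congr rfl fun x _ => nodeConductance_reversibleConductance hP x

/-- **§9.1, converse: `c(x,y) = π(x)P(x,y)` is a conductance matrix** for a chain reversible with
respect to a positive `π` ("This is symmetric by reversibility"). [cite: LevinPeres2017, §9.1 (last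
paragraph of the section)] -/
theorem isConductance_reversibleConductance (hP : IsRowStochastic P) (hDB : DetailedBalance π P)
    (hπ : ∀ x, 0 < π x) : IsConductance (reversibleConductance π P) := by
  refine ⟨fun x y => ?_, fun x y => ?_, fun x => ?_⟩
  · rw [reversibleConductance_apply, reversibleConductance_apply, hDB x y]
  · rw [reversibleConductance_apply]
    exact mul_nonneg (hπ x).le (hP.1 x y)
  · rw [← nodeConductance_def, nodeConductance_reversibleConductance hP]
    exact hπ x

/-- **§9.1, converse: "the transition matrix associated with this network is just `P`"** — every
reversible chain (with positive reversing measure) is the weighted random walk on the network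
`c(x,y) = π(x)P(x,y)`. [cite: LevinPeres2017, §9.1 (last paragraph: "The study of reversible Markov
chains is thus equivalent to the study of random walks on networks")] -/
theorem LevinPeres2017_sec_9_1_converse (hP : IsRowStochastic P) (hπ : ∀ x, 0 < π x) :
    networkKernel (reversibleConductance π P) = P := by
  ext x y
  rw [networkKernel_apply, nodeConductance_reversibleConductance hP, reversibleConductance_apply,
    mul_div_cancel_left₀ _ (hπ x).ne']

/-- … and its law `c(x)/c_G` is `π` itself when `Σ π = 1`. [cite: LevinPeres2017, §9.1 (`c(x) = π(x)`)] -/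
theorem networkLaw_reversibleConductance (hP : IsRowStochastic P) (hπ1 : ∑ x, π x = 1) :
    networkLaw (reversibleConductance π P) = π := by
  funext x
  rw [networkLaw_apply, nodeConductance_reversibleConductance hP,
    totalConductance_reversibleConductance hP, hπ1, div_one]

end Converse

end Basic

/-! ## Unit conductances on a simple graph: the simple random walk -/

section SimpleGraph

variable {V : Type*} [Fintype V] {G : SimpleGraph V} [DecidableRel G.Adj]

/-- With all edge weights equal to `1` (the adjacency matrix as conductance matrix), `c(x) = deg(x)`.
[cite: LevinPeres2017, §9.1 ("Simple random walk on `G` is the special case where all the edge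
weights are equal to 1")] -/
theorem nodeConductance_adjMatrix (x : V) : nodeConductance (G.adjMatrix ℝ) x = G.degree x := by
  rw [nodeConductance_def]
  simp_rw [adjMatrix_apply]
  exact (G.degree_eq_sum_if_adj x).symm

/-- The adjacency matrix of a graph without isolated vertices is a conductance matrix.
[cite: LevinPeres2017, §9.1 (simple random walk as the unit-conductance network)] -/
theorem isConductance_adjMatrix (hdeg : ∀ x, 0 < G.degree x) : IsConductance (G.adjMatrix ℝ) := by
  refine ⟨fun x y => ?_, fun x y => ?_, fun x => ?_⟩
  · rw [adjMatrix_apply, adjMatrix_apply]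
    simp [G.adj_comm]
  · rw [adjMatrix_apply]
    split_ifs <;> norm_num
  · rw [← nodeConductance_def, nodeConductance_adjMatrix]
    exact_mod_cast hdeg x

/-- **The unit-conductance network walk is the simple random walk (1.13).**
[cite: LevinPeres2017, §9.1 ("Simple random walk on `G` is the special case where all the edge weights
are equal to 1")] -/
theorem networkKernel_adjMatrix : networkKernel (G.adjMatrix ℝ) = srwKernel G := by
  ext x y
  rw [networkKernel_apply, nodeConductance_adjMatrix, srwKernel_apply, adjMatrix_apply]
  split_ifs <;> simp

/-- … and its reversible law `c(x)/c_G` is `deg(x)/2|E|` (Example 1.12). [cite: LevinPeres2017, §9.1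
with §1.5 Example 1.12] -/
theorem networkLaw_adjMatrix : networkLaw (G.adjMatrix ℝ) = degreeLaw G := by
  funext x
  rw [networkLaw_apply, degreeLaw_apply, nodeConductance_adjMatrix, totalConductance_def]
  simp_rw [nodeConductance_adjMatrix]
  congr 1
  exact_mod_cast G.sum_degrees_eq_twice_card_edges

end SimpleGraph

end Literature.Probability.MarkovChains
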